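import Summits.PneNP.PneNP.Theorems.SymmetryBudgetNoHiddenOrderBranchSumPotential

/-!
# BranchSum II: the structure of a bad step — giants, the hub, the type bound, exhaustion

Part B of the proof of CG84-FLATNESS.md Theorem 9.1 (abstract form, §9.3) for a `RefinementPath`:
in a BAD step `k` (`2Δ_k < d_k`)

* `exists_giant_vertex` — every cell keeps a giant (a surviving piece of more than half the cell);
* `not_swAdj_of_removed` — a vertex removed at `k → k+1` has no switching-edge to a giant (H4 + Fact S);
* `exists_hub` — H3 then yields a HUB: a halved surviving vertex `z` switching-adjacent to a giant
  vertex `y`;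
* `swDeg_eq_of_same_cell` — uniformity of switching degrees between cells of node `k+1` (H2);
* `two_mul_card_type_le` — the TYPE BOUND: giant vertices with a common switching-neighbourhood in
  the hub cell are at most half of the giant;
* `two_mul_card_cell_le_of_exhausted` — EXHAUSTION: once the hub cell is entirely removed, every
  cell inside the giant is at most half of it (H4).
-/

namespace Summit.PneNP.PneNP.Theorems

open Finset

namespace BranchSum

variable {V : Type*} [DecidableEq V] {G : SimpleGraph V} [DecidableRel G.Adj] {N : ℕ}

namespace RefinementPath

variable (R : RefinementPath G N)

/-! ### Part B: the structure of a bad step -/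

/-- Not removed-or-halved means: surviving in a piece of more than half the cell (a GIANT vertex). -/
theorem not_event_iff {k : ℕ} {v : V} :
    ¬ R.Event k v ↔ v ∈ R.W (k + 1) ∧ (R.cell k v).card < 2 * (R.cell (k + 1) v).card := by
  unfold Event; push Not; rfl

/-- H5 in use: some vertex is removed at every transition `k → k+1`, `k < N`. -/
theorem exists_removed {k : ℕ} (hk : k < N) : ∃ x ∈ R.W k, x ∉ R.W (k + 1) := by
  by_contra h
  push Not at h
  exact R.progress k hk (Subset.antisymm (R.nest k) h)

/-- In a bad step every cell keeps a GIANT: a vertex of the cell that survives un-halved. -/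
theorem exists_giant_vertex {k : ℕ} (hbad : R.Bad k) {u : V} (hu : u ∈ R.W k) :
    ∃ v ∈ R.cell k u, ¬ R.Event k v := by
  by_contra h
  push Not at h
  have hsub : R.cell k u ⊆ (R.W k).filter fun w => R.Event k w := fun v hv =>
    mem_filter.2 ⟨R.cell_subset_W k u hv, h v hv⟩
  have h1 : R.d k ≤ R.delta k := (R.d_le k u hu).trans (card_le_card hsub)
  unfold Bad at hbad
  omega

/-- Switching adjacency from a fixed vertex is constant along a set to which it is homogeneous
inside one block. -/
theorem swAdj_iff_of_homogeneous {k : ℕ} {v y y' : V} (hcol : R.col k y' = R.col k y) (hne : v ≠ y')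
    (hhom : G.Adj v y' ↔ G.Adj v y) (h : (R.sw k).Adj v y) : (R.sw k).Adj v y' := by
  rw [swGraph_adj] at h ⊢
  refine ⟨hne, ?_⟩
  rw [swComp_congr G rfl hcol, hhom]
  exact h.2

/-- A vertex removed at `k → k+1` has no switching-edge (at node `k`) to a giant. -/
theorem not_swAdj_of_removed {k : ℕ} {v y : V} (hv : v ∈ R.W k) (hv' : v ∉ R.W (k + 1))
    (hy : y ∈ R.W (k + 1)) (hgiant : (R.cell k y).card < 2 * (R.cell (k + 1) y).card) :
    ¬ (R.sw k).Adj v y := by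
  intro hadj
  have hyk : y ∈ R.W k := R.nest k hy
  have hYC : R.cell (k + 1) y ⊆ R.cell k y := R.cell_subset_cell_of_le (Nat.le_succ k) hy
  have hhom := R.removal k (k + 1) (Nat.lt_succ_self k) v hv hv' y hy
  -- every vertex of the giant is a switching-neighbour of `v`
  have hall : R.cell (k + 1) y ⊆ (R.cell k y).filter fun t => (R.sw k).Adj v t := by
    intro y' hy'
    have hy'W : y' ∈ R.W (k + 1) := R.cell_subset_W (k + 1) y hy'
    refine mem_filter.2 ⟨hYC hy', R.swAdj_iff_of_homogeneous ?_ ?_ ?_ hadj⟩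
    · exact (R.mem_cell_iff.1 (hYC hy')).2
    · rintro rfl; exact hv' hy'W
    · rcases hhom with h | h
      · exact iff_of_true (h y' hy') (h y (R.self_mem_cell hy))
      · exact iff_of_false (h y' hy') (h y (R.self_mem_cell hy))
  have h1 := card_le_card hall
  have h2 := R.two_mul_swDeg_le k hv hyk
  omega

/-- **Hub.** In a bad step `k < N` there are a halved surviving vertex `z` and a giant vertex `y`
joined by a switching-edge of node `k`. -/
theorem exists_hub {k : ℕ} (hk : k < N) (hbad : R.Bad k) :
    ∃ z ∈ R.W (k + 1), ∃ y ∈ R.W (k + 1), 2 * (R.cell (k + 1) z).card ≤ (R.cell k z).card ∧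
      (R.cell k y).card < 2 * (R.cell (k + 1) y).card ∧ (R.sw k).Adj z y := by
  obtain ⟨x, hx, hx'⟩ := R.exists_removed hk
  set S := (R.W k).filter fun w => R.Event k w with hS
  have hSne : S.Nonempty := ⟨x, mem_filter.2 ⟨hx, Or.inl hx'⟩⟩
  have hSW : S ⊆ R.W k := filter_subset _ _
  have hSneW : S ≠ R.W k := by
    obtain ⟨v, hv, hvE⟩ := R.exists_giant_vertex hbad hx
    intro hSW'
    have : v ∈ S := hSW' ▸ R.cell_subset_W k x hv
    exact hvE (mem_filter.1 this).2
  obtain ⟨a, ha, b, hb, hab⟩ := R.connected k S hSW hSne hSneW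
  rw [mem_sdiff] at hb
  have hbE : ¬ R.Event k b := fun h => hb.2 (mem_filter.2 ⟨hb.1, h⟩)
  rw [not_event_iff] at hbE
  have haW : a ∈ R.W k := hSW ha
  by_cases ha1 : a ∈ R.W (k + 1)
  · refine ⟨a, ha1, b, hbE.1, ?_, hbE.2, hab⟩
    rcases (mem_filter.1 ha).2 with h | h
    · exact absurd ha1 h
    · exact h
  · exact absurd hab (R.not_swAdj_of_removed haW ha1 hbE.1 hbE.2)

/-! ### Part B continued: uniformity of switching degrees, the type bound, exhaustion -/

/-- On a complemented block, switching-neighbours are the non-neighbours. -/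
theorem filter_swAdj_of_comp {k : ℕ} {u w : V} {T : Finset V} (hT : ∀ t ∈ T, R.col k t = R.col k w)
    (huT : u ∉ T) (hcomp : SwComp G (R.W k) (R.col k) u w) :
    (T.filter fun t => (R.sw k).Adj u t) = T.filter fun t => ¬ G.Adj u t := by
  ext t
  simp only [mem_filter, swGraph_adj, and_congr_right_iff]
  intro ht
  have hc : SwComp G (R.W k) (R.col k) u t ↔ SwComp G (R.W k) (R.col k) u w :=
    swComp_congr G rfl (hT t ht)
  constructor
  · rintro ⟨-, hiff⟩
    exact hiff.1 (hc.2 hcomp)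
  · intro hna
    exact ⟨fun h => huT (h ▸ ht), iff_of_true (hc.2 hcomp) hna⟩

/-- On a kept block, switching-neighbours are the neighbours. -/
theorem filter_swAdj_of_not_comp {k : ℕ} {u w : V} {T : Finset V} (hT : ∀ t ∈ T, R.col k t = R.col k w)
    (hcomp : ¬ SwComp G (R.W k) (R.col k) u w) :
    (T.filter fun t => (R.sw k).Adj u t) = T.filter fun t => G.Adj u t := by
  ext t
  simp only [mem_filter, swGraph_adj, and_congr_right_iff]
  intro ht
  have hc : SwComp G (R.W k) (R.col k) u t ↔ SwComp G (R.W k) (R.col k) u w :=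
    swComp_congr G rfl (hT t ht)
  constructor
  · rintro ⟨-, hiff⟩
    by_contra hna
    exact hcomp (hc.1 (hiff.2 hna))
  · intro ha
    exact ⟨G.ne_of_adj ha, iff_of_false (fun h => hcomp (hc.1 h)) (not_not.2 ha)⟩

/-- **Uniformity.** Two vertices of one cell of node `k+1` have the same number of node-`k`
switching-neighbours in any other cell of node `k+1`. -/
theorem swDeg_eq_of_same_cell {k : ℕ} {u u' w : V} (hu : u ∈ R.W (k + 1)) (hu' : u' ∈ R.W (k + 1))
    (hcol : R.col (k + 1) u = R.col (k + 1) u') (hw : w ∈ R.W (k + 1))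
    (hne : R.col (k + 1) w ≠ R.col (k + 1) u) :
    ((R.cell (k + 1) w).filter fun t => (R.sw k).Adj u t).card =
      ((R.cell (k + 1) w).filter fun t => (R.sw k).Adj u' t).card := by
  have hTW : R.cell (k + 1) w ⊆ R.cell k w := R.cell_subset_cell_of_le (Nat.le_succ k) hw
  have hT : ∀ t ∈ R.cell (k + 1) w, R.col k t = R.col k w := fun t ht => (R.mem_cell_iff.1 (hTW ht)).2
  have hcolk : R.col k u = R.col k u' := R.colNest k u hu u' hu' hcol
  have huT : u ∉ R.cell (k + 1) w := fun h => hne (R.mem_cell_iff.1 h).2.symm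
  have hu'T : u' ∉ R.cell (k + 1) w := fun h => hne ((R.mem_cell_iff.1 h).2.symm.trans hcol.symm)
  have heq := R.equitable (k + 1) u hu u' hu' hcol w hw
  have hadd := card_filter_add_card_filter_not (s := R.cell (k + 1) w) (fun t => G.Adj u t)
  have hadd' := card_filter_add_card_filter_not (s := R.cell (k + 1) w) (fun t => G.Adj u' t)
  by_cases hcomp : SwComp G (R.W k) (R.col k) u w
  · have hcomp' : SwComp G (R.W k) (R.col k) u' w := (swComp_congr G hcolk.symm rfl).2 hcomp
    rw [R.filter_swAdj_of_comp hT huT hcomp, R.filter_swAdj_of_comp hT hu'T hcomp']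
    change ((R.cell (k + 1) w).filter fun t => G.Adj u t).card =
      ((R.cell (k + 1) w).filter fun t => G.Adj u' t).card at heq
    omega
  · have hcomp' : ¬ SwComp G (R.W k) (R.col k) u' w := fun h => hcomp ((swComp_congr G hcolk.symm rfl).1 h)
    rw [R.filter_swAdj_of_not_comp hT hcomp, R.filter_swAdj_of_not_comp hT hcomp']
    exact heq

/-- In the hub configuration the halved cell and the giant are different cells of node `k+1`. -/
theorem col_ne_of_hub {k : ℕ} {z y : V} (hz : z ∈ R.W (k + 1)) (hy : y ∈ R.W (k + 1))
    (hzh : 2 * (R.cell (k + 1) z).card ≤ (R.cell k z).card)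
    (hyg : (R.cell k y).card < 2 * (R.cell (k + 1) y).card) : R.col (k + 1) y ≠ R.col (k + 1) z := by
  intro h
  have h1 : R.cell (k + 1) y = R.cell (k + 1) z := cellOf_eq_of_col_eq h
  have h2 : R.cell k y = R.cell k z := cellOf_eq_of_col_eq (R.colNest k y hy z hz h)
  rw [h1, h2] at hyg
  omega

/-- Every giant vertex has at least one switching-neighbour in the hub cell `Z`. -/
theorem one_le_swDeg_hub {k : ℕ} {z y u : V} (hz : z ∈ R.W (k + 1)) (hy : y ∈ R.W (k + 1))
    (hzh : 2 * (R.cell (k + 1) z).card ≤ (R.cell k z).card)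
    (hyg : (R.cell k y).card < 2 * (R.cell (k + 1) y).card) (hadj : (R.sw k).Adj z y)
    (hu : u ∈ R.cell (k + 1) y) :
    1 ≤ ((R.cell (k + 1) z).filter fun t => (R.sw k).Adj u t).card := by
  have huW : u ∈ R.W (k + 1) := R.cell_subset_W _ _ hu
  have hcolu : R.col (k + 1) u = R.col (k + 1) y := (R.mem_cell_iff.1 hu).2
  rw [R.swDeg_eq_of_same_cell huW hy hcolu hz fun h => R.col_ne_of_hub hz hy hzh hyg (hcolu.symm.trans h.symm)]
  exact card_pos.2 ⟨z, mem_filter.2 ⟨R.self_mem_cell hz, hadj.symm⟩⟩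

/-- The hub vertex `z` is switching-adjacent to fewer than `|G'|` vertices of the giant `G'`. -/
theorem swDeg_hub_lt {k : ℕ} {z y : V} (hz : z ∈ R.W (k + 1)) (hy : y ∈ R.W (k + 1))
    (hyg : (R.cell k y).card < 2 * (R.cell (k + 1) y).card) :
    ((R.cell (k + 1) y).filter fun t => (R.sw k).Adj z t).card < (R.cell (k + 1) y).card := by
  have h1 : ((R.cell (k + 1) y).filter fun t => (R.sw k).Adj z t) ⊆
      (R.cell k y).filter fun t => (R.sw k).Adj z t :=
    filter_subset_filter _ (R.cell_subset_cell_of_le (Nat.le_succ k) hy)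
  have h2 := card_le_card h1
  have h3 := R.two_mul_swDeg_le k (R.nest k hz) (R.nest k hy)
  omega

/-- **Type bound.** In the hub configuration, the giant vertices sharing the switching-neighbourhood
in `Z` of a given giant vertex `u` are at most half of the giant. -/
theorem two_mul_card_type_le {k : ℕ} {z y : V} (hz : z ∈ R.W (k + 1)) (hy : y ∈ R.W (k + 1))
    (hzh : 2 * (R.cell (k + 1) z).card ≤ (R.cell k z).card)
    (hyg : (R.cell k y).card < 2 * (R.cell (k + 1) y).card) (hadj : (R.sw k).Adj z y)
    {u : V} (hu : u ∈ R.cell (k + 1) y) :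
    2 * ((R.cell (k + 1) y).filter fun u' =>
        ((R.cell (k + 1) z).filter fun t => (R.sw k).Adj u' t) =
          (R.cell (k + 1) z).filter fun t => (R.sw k).Adj u t).card ≤ (R.cell (k + 1) y).card := by
  have hne := R.col_ne_of_hub hz hy hzh hyg
  have hcu : R.col (k + 1) u = R.col (k + 1) y := (R.mem_cell_iff.1 hu).2
  have huW : u ∈ R.W (k + 1) := R.cell_subset_W _ _ hu
  -- (i) the type of `u` is nonempty
  have hTu : ((R.cell (k + 1) z).filter fun t => (R.sw k).Adj u t).Nonempty :=
    card_pos.1 (R.one_le_swDeg_hub hz hy hzh hyg hadj hu)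
  -- (ii) the type of `u` is not all of `Z`
  have hTuZ : ((R.cell (k + 1) z).filter fun t => (R.sw k).Adj u t) ≠ R.cell (k + 1) z := by
    intro hTZ
    have hall : R.cell (k + 1) y ⊆ (R.cell (k + 1) y).filter fun t => (R.sw k).Adj z t := by
      intro u' hu'
      have hu'W : u' ∈ R.W (k + 1) := R.cell_subset_W _ _ hu'
      have hcol : R.col (k + 1) u' = R.col (k + 1) u := (R.mem_cell_iff.1 hu').2.trans hcu.symm
      have hcard : ((R.cell (k + 1) z).filter fun t => (R.sw k).Adj u' t).card = (R.cell (k + 1) z).card := by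
        rw [R.swDeg_eq_of_same_cell hu'W huW hcol hz fun h => hne ((hcol.trans hcu).symm.trans h.symm), hTZ]
      have hTZ' : ((R.cell (k + 1) z).filter fun t => (R.sw k).Adj u' t) = R.cell (k + 1) z :=
        eq_of_subset_of_card_le (filter_subset _ _) hcard.ge
      have hz' : z ∈ (R.cell (k + 1) z).filter fun t => (R.sw k).Adj u' t := by
        rw [hTZ']; exact R.self_mem_cell hz
      exact mem_filter.2 ⟨hu', ((mem_filter.1 hz').2).symm⟩
    have h1 := card_le_card hall
    have h2 := R.swDeg_hub_lt hz hy hyg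
    omega
  obtain ⟨z₁, hz₁⟩ := hTu
  obtain ⟨z₂, hz₂Z, hz₂T⟩ : ∃ z₂ ∈ R.cell (k + 1) z, z₂ ∉ (R.cell (k + 1) z).filter fun t => (R.sw k).Adj u t := by
    by_contra h
    push Not at h
    exact hTuZ (Subset.antisymm (filter_subset _ _) h)
  have hz₁Z : z₁ ∈ R.cell (k + 1) z := (mem_filter.1 hz₁).1
  -- κ(z₁) ≥ |U|
  have hk1 : ((R.cell (k + 1) y).filter fun u' =>
        ((R.cell (k + 1) z).filter fun t => (R.sw k).Adj u' t) =
          (R.cell (k + 1) z).filter fun t => (R.sw k).Adj u t).card ≤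
      ((R.cell (k + 1) y).filter fun t => (R.sw k).Adj z₁ t).card := by
    refine card_le_card fun u' hu' => ?_
    rw [mem_filter] at hu'
    refine mem_filter.2 ⟨hu'.1, ?_⟩
    have : z₁ ∈ (R.cell (k + 1) z).filter fun t => (R.sw k).Adj u' t := hu'.2 ▸ hz₁
    exact ((mem_filter.1 this).2).symm
  -- κ(z₂) ≤ |G'| - |U|
  have hk2 : ((R.cell (k + 1) y).filter fun t => (R.sw k).Adj z₂ t).card +
      ((R.cell (k + 1) y).filter fun u' =>
        ((R.cell (k + 1) z).filter fun t => (R.sw k).Adj u' t) =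
          (R.cell (k + 1) z).filter fun t => (R.sw k).Adj u t).card ≤ (R.cell (k + 1) y).card := by
    rw [← card_union_of_disjoint]
    · exact card_le_card (union_subset (filter_subset _ _) (filter_subset _ _))
    · rw [disjoint_left]
      intro u' h1 h2
      rw [mem_filter] at h1 h2
      have : z₂ ∈ (R.cell (k + 1) z).filter fun t => (R.sw k).Adj u' t := mem_filter.2 ⟨hz₂Z, h1.2.symm⟩
      exact hz₂T (h2.2 ▸ this)
  -- κ(z₁) = κ(z₂)
  have hzW : ∀ t ∈ R.cell (k + 1) z, t ∈ R.W (k + 1) := fun t ht => R.cell_subset_W _ _ ht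
  have hk12 : ((R.cell (k + 1) y).filter fun t => (R.sw k).Adj z₁ t).card =
      ((R.cell (k + 1) y).filter fun t => (R.sw k).Adj z₂ t).card :=
    R.swDeg_eq_of_same_cell (hzW z₁ hz₁Z) (hzW z₂ hz₂Z)
      ((R.mem_cell_iff.1 hz₁Z).2.trans (R.mem_cell_iff.1 hz₂Z).2.symm) hy
      (fun h => hne (h.trans (R.mem_cell_iff.1 hz₁Z).2))
  omega

/-- **Exhaustion.** Once every vertex of the hub cell `Z` has been removed (node `k' > k+1`), every
cell of node `k'` inside the giant `G'` has at most half the size of `G'`. -/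
theorem two_mul_card_cell_le_of_exhausted {k k' : ℕ} {z y : V} (hz : z ∈ R.W (k + 1)) (hy : y ∈ R.W (k + 1))
    (hzh : 2 * (R.cell (k + 1) z).card ≤ (R.cell k z).card)
    (hyg : (R.cell k y).card < 2 * (R.cell (k + 1) y).card) (hadj : (R.sw k).Adj z y)
    (hk' : k + 1 < k') (hgone : ∀ t ∈ R.cell (k + 1) z, t ∉ R.W k')
    {w : V} (hw : w ∈ R.W k') (hwG : w ∈ R.cell (k + 1) y) :
    2 * (R.cell k' w).card ≤ (R.cell (k + 1) y).card := by
  have hYG : R.cell k' w ⊆ R.cell (k + 1) y :=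
    (R.cell_subset_cell_of_le hk'.le hw).trans (R.cell_eq_of_mem hwG).subset
  -- all vertices of `cell k' w` have the same type as `w`
  have htype : R.cell k' w ⊆ (R.cell (k + 1) y).filter fun u' =>
      ((R.cell (k + 1) z).filter fun t => (R.sw k).Adj u' t) =
        (R.cell (k + 1) z).filter fun t => (R.sw k).Adj w t := by
    intro w' hw'
    refine mem_filter.2 ⟨hYG hw', ?_⟩
    have hw'W : w' ∈ R.W k' := R.cell_subset_W _ _ hw'
    have hcolk : R.col k w' = R.col k w :=
      R.col_eq_of_le (Nat.le_of_succ_le hk'.le) hw'W hw (R.mem_cell_iff.1 hw').2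
    ext t
    simp only [mem_filter, and_congr_right_iff]
    intro ht
    have htW : t ∈ R.W (k + 1) := R.cell_subset_W _ _ ht
    have htk' : t ∉ R.W k' := hgone t ht
    have hhom := R.removal (k + 1) k' hk' t htW htk' w hw
    have hadjiff : G.Adj t w' ↔ G.Adj t w := by
      rcases hhom with h | h
      · exact iff_of_true (h w' hw') (h w (R.self_mem_cell hw))
      · exact iff_of_false (h w' hw') (h w (R.self_mem_cell hw))
    have hne1 : w' ≠ t := by rintro rfl; exact htk' hw'W
    have hne2 : w ≠ t := by rintro rfl; exact htk' hw
    rw [swGraph_adj, swGraph_adj, swComp_congr G hcolk rfl, G.adj_comm w' t, G.adj_comm w t, hadjiff]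
    simp [hne1, hne2]
  calc 2 * (R.cell k' w).card ≤ 2 * _ := Nat.mul_le_mul_left 2 (card_le_card htype)
    _ ≤ (R.cell (k + 1) y).card := R.two_mul_card_type_le hz hy hzh hyg hadj hwG


end RefinementPath

end BranchSum

end Summit.PneNP.PneNP.Theorems
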